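import Literature.AnabelianGeometry.EtaleTheta.Discharge.Sec3Remark364
import HarnessLib

/-!
# [EtTh] Remark 3.6.5 (perfection half): passing to the base-field-theoretic part COMMUTES with perfection

S. Mochizuki, *The étale theta function and its Frobenioid-theoretic manifestations*, Publ. RIMS **45** (2009) [EtTh], §3,
Remark 3.6.5, PRIMS PDF p. 79 (printed 305) l. 16–19 [cite: MochizukiEtTh2009, Rmk 3.6.5 p.79]:

> "One verifies immediately that, when applied to a tempered Frobenioid, the operations of perfection and
> realification [cf. Remark 3.6.4] are compatible with the operation of passing to the associated
> base-field-theoretic hull of the tempered Frobenioid."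

Layer L2 of the abc-iut cell, seat abc-iut-w6-d076 (gen 5), row «RMK365/366-DECLS» (abc-iut-L2-lead R1105, from the M14
«§3 REMARKS» census which classed EtTh:Rmk3.6.5 «R-b: claim-bearing without decl»). PROOF-ONLY (0 definitions; nothing
landed is edited or restated) over abc-iut-L2-t3's `TemperedFrobenioid` record (`TemperedFrobenioid.lean`: `Φ ⊆ Φ^{ℝ-log}`, the
base-field-theoretic part `bsFld := Φ ×_{(Φ^{ℝ-log})^gp} ℝ·Φ₀^cnst`, the root-closure field `RealifiedDivisorMonoids.cnstR_root`
= print's "`ℝ`-vector subspace" clause of Def. 3.6 (i)), abc-iut-L2-t3's §0 `perfSaturation` (`Conventions.lean`) and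
abc-iut-L2-d2's generic `perfSaturation_inf_eq_of_rootClosed` (`Discharge/Sec3Remark364`).

WHAT IS TYPED AND PROVED (the DIVISOR-MONOID content of the perfection half of the Remark; by Remark 3.6.4 the divisor monoid
of the perfection `C^pf` is the perf-saturation `Φ^pf(A) = perfSaturation Φ(A) ⊆ Φ^{ℝ-log}(A)`, and by Def. 3.6 (iv) the hull's
divisor monoid is `Φ^{bs-fld}`):

* `remark365_perfSaturation_inf_cnstR` — for every object `A`,
  `perfSaturation Φ(A) ⊓ (ℝ·Φ₀^cnst) = perfSaturation (Φ(A) ⊓ ℝ·Φ₀^cnst)`, i.e. **the base-field-theoretic part of `Φ^pf`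
  IS the perf-saturation of `Φ^{bs-fld}`**: `(Φ^pf)^{bs-fld} = (Φ^{bs-fld})^pf` — HYPOTHESIS-FREE for every tempered
  Frobenioid `C₀ : TemperedFrobenioid T D VD` (any monoid vocabulary `V`);
* `remark365_perfSaturation_bsFld` — the same in the `bsFld` currency;
* the two inclusions separately (`perfSaturation_bsFld_le`, `le_perfSaturation_bsFld`) and the elementwise form
  `mem_perfSaturation_bsFld_iff` for consumers.

NOT TYPED HERE (displayed, R-b residual of the row): the REALIFICATION half — it needs an `ℝ`-saturation operator on
`Φ ⊆ Φ^{ℝ-log}` at the monoid level (the tree's realification is the categorical universal property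
`RealificationFunctor` / `RlfUniversal`); and Remark 3.6.6 («`Φ` perfect ⇒ Def. 3.6 (ii)(a) ⟸ (b)»), which needs an `ℝ`-LINE
structure on `ℝ·Φ₀^cnst` beyond `cnstR_root` (cf. abc-iut-w5-d164's binder `hLine` in `Sec3Remark362OfCnst`). HONEST FRAMING:
refereed pre-IUT material; nothing of [EtTh] is asserted beyond what is proved; typed ≠ proved; no side is taken on
[IUTchIII] Cor. 3.12.
-/

namespace Literature.AnabelianGeometry.EtaleTheta

open CategoryTheory Opposite Literature.AlgebraicGeometry.Frobenioids

universe u₀ v₀ u v w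

namespace TemperedFrobenioid

variable {D₀ : Type u₀} [Category.{v₀} D₀] {V : FrdIMonoidStub.{w}} {T : RealifiedDivisorMonoids (D₀ := D₀) V}
  {D : Type u} [Category.{v} D] {VD : FrdICatStub.{u, v, w} D} (C₀ : TemperedFrobenioid T D VD)

/-- `ℝ·Φ₀^cnst`, pulled back to `Φ^{ℝ-log}(A)`, is ROOT-CLOSED (`x^n ∈ ℝ·Φ₀^cnst ⇒ x ∈ ℝ·Φ₀^cnst`, `n ≥ 1`) — the structure
field `RealifiedDivisorMonoids.cnstR_root` read on elements of `Φ^{ℝ-log}(A)`. [cite: MochizukiEtTh2009, Def 3.6 p.76] -/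
theorem cnstR_comap_rootClosed (A : Dᵒᵖ) (x : C₀.ΦRlog.obj A) (n : ℕ+)
    (hx : x ^ (n : ℕ) ∈ (T.cnstR (C₀.baseOp A)).toSubmonoid.comap Algebra.GrothendieckGroup.of) :
    x ∈ (T.cnstR (C₀.baseOp A)).toSubmonoid.comap Algebra.GrothendieckGroup.of := by
  have hx' : Algebra.GrothendieckGroup.of (x ^ (n : ℕ)) ∈ T.cnstR (C₀.baseOp A) := hx
  rw [map_pow] at hx'
  exact T.cnstR_root _ _ n hx'

/-- **[EtTh] Remark 3.6.5, perfection half, divisor-monoid form**: for every object `A` of a tempered Frobenioid,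
`perfSaturation Φ(A) ⊓ ℝ·Φ₀^cnst = perfSaturation (Φ(A) ⊓ ℝ·Φ₀^cnst)` — the base-field-theoretic part of the perfection's
divisor monoid `Φ^pf` (Remark 3.6.4) is the perf-saturation of the hull's divisor monoid `Φ^{bs-fld}` (Def. 3.6 (iv)):
"perfection is compatible with passing to the base-field-theoretic hull". Hypothesis-free.
[cite: MochizukiEtTh2009, Rmk 3.6.5 p.79] -/
theorem remark365_perfSaturation_inf_cnstR (A : Dᵒᵖ) :
    perfSaturation (C₀.Φ.carrier A) ⊓ (T.cnstR (C₀.baseOp A)).toSubmonoid.comap Algebra.GrothendieckGroup.of =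
      perfSaturation (C₀.Φ.carrier A ⊓ (T.cnstR (C₀.baseOp A)).toSubmonoid.comap Algebra.GrothendieckGroup.of) :=
  perfSaturation_inf_eq_of_rootClosed _ _ (C₀.cnstR_comap_rootClosed A)

/-- **Remark 3.6.5, perfection half, in the `bsFld` currency**: `(Φ^pf)^{bs-fld}(A) = perfSaturation (Φ^{bs-fld}(A))`.
[cite: MochizukiEtTh2009, Rmk 3.6.5 p.79] -/
theorem remark365_perfSaturation_bsFld (A : Dᵒᵖ) :
    perfSaturation (C₀.Φ.carrier A) ⊓ (T.cnstR (C₀.baseOp A)).toSubmonoid.comap Algebra.GrothendieckGroup.of =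
      perfSaturation (C₀.bsFld.carrier A) :=
  C₀.remark365_perfSaturation_inf_cnstR A

/-- Elementwise reading: `x ∈ Φ^{ℝ-log}(A)` lies in the base-field-theoretic part of `Φ^pf(A)` iff some positive power of
`x` lies in `Φ^{bs-fld}(A)`. [cite: MochizukiEtTh2009, Rmk 3.6.5 p.79] -/
theorem mem_perfSaturation_bsFld_iff (A : Dᵒᵖ) (x : C₀.ΦRlog.obj A) :
    (x ∈ perfSaturation (C₀.Φ.carrier A) ∧
        x ∈ (T.cnstR (C₀.baseOp A)).toSubmonoid.comap Algebra.GrothendieckGroup.of) ↔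
      x ∈ perfSaturation (C₀.bsFld.carrier A) := by
  have h := SetLike.ext_iff.mp (C₀.remark365_perfSaturation_bsFld A) x
  exact Iff.trans Submonoid.mem_inf.symm h

/-- One inclusion: the perf-saturation of `Φ^{bs-fld}(A)` lies in the base-field-theoretic part of `Φ^pf(A)`.
[cite: MochizukiEtTh2009, Rmk 3.6.5 p.79] -/
theorem perfSaturation_bsFld_le (A : Dᵒᵖ) :
    perfSaturation (C₀.bsFld.carrier A) ≤
      perfSaturation (C₀.Φ.carrier A) ⊓ (T.cnstR (C₀.baseOp A)).toSubmonoid.comap Algebra.GrothendieckGroup.of :=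
  (C₀.remark365_perfSaturation_bsFld A).ge

/-- The other inclusion: the base-field-theoretic part of `Φ^pf(A)` lies in the perf-saturation of `Φ^{bs-fld}(A)` (this is
the direction that USES the root-closure of `ℝ·Φ₀^cnst`). [cite: MochizukiEtTh2009, Rmk 3.6.5 p.79] -/
theorem le_perfSaturation_bsFld (A : Dᵒᵖ) :
    perfSaturation (C₀.Φ.carrier A) ⊓ (T.cnstR (C₀.baseOp A)).toSubmonoid.comap Algebra.GrothendieckGroup.of ≤
      perfSaturation (C₀.bsFld.carrier A) :=
  (C₀.remark365_perfSaturation_bsFld A).le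

/-- The perf-saturation of `Φ^{bs-fld}(A)` lies inside `Φ^pf(A) = perfSaturation Φ(A)` (monotonicity half, for consumers of
Remark 3.6.4's `Remark364`). [cite: MochizukiEtTh2009, Rmk 3.6.5 p.79] -/
theorem perfSaturation_bsFld_le_perfSaturation (A : Dᵒᵖ) :
    perfSaturation (C₀.bsFld.carrier A) ≤ perfSaturation (C₀.Φ.carrier A) :=
  (C₀.perfSaturation_bsFld_le A).trans inf_le_left

end TemperedFrobenioid

end Literature.AnabelianGeometry.EtaleTheta
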